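import Summits.BirchSwinnertonDyer.BirchSwinnertonDyer.Theorems.PrintCf2SplitBadTwoRestrictedSelmerBottomShaEigen
import HarnessLib

/-!
# Crux `PrintCf2.SplitBadTwoRankOneOfFacts` (stmt-BirchSwinnertonDyer-20368), road α, stub S3c — the `𝔮_r`-EIGEN PART of the image of
# `H¹(K, E[p^∞])` in `H¹(K, E)` IS the image of `H¹(K, E[𝔮_r^∞])` (converse of `…BottomShaEigen`, pure eigen algebra)

Cell `bsd-print-cf2`, width seat `bsd-line-cf2-p1-w7` g2, file 10 of the bottom-value lane (… p666248 `…BottomShaEigen`); `--supports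
stmt-BirchSwinnertonDyer-20368` (helper, Theses-free). HONEST FRAMING: nothing here closes a crux or a stub; BSD is not proved by any of this; no
summit statement is proved by this seat. No definition, no named fact, no `sorry`, no kit. beyond-print theorem: no.

WHAT. With `M_r = E[𝔮_r^∞]`, `M_{r′} = E[𝔮_{r′}^∞]` complementary (`⊓ = ⊥`, `⊔ = ⊤`, `r − r′` a unit: road α `r′ = 1 − r`), an equivariant `f₀` acting
on `M_r` as `r` and on `M_{r′}` as `r′` (e.g. `π`, p666248 `eigen_of_endRing`), `R = res_⊤`, `P = primaryH1ToH1`, `Φ = galH1Map f₀`, and the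
eigen predicate `Eig_s(x) :≡ ∀ k N, p^k • x = 0 → N ≡ s (p^k) → Φ x = N • x` (-w8's membership predicate of `C`):
* §1 (generic abelian group, any `Φ`): `eigen_sub` (`Eig_s` is closed under differences of `p`-power-torsion elements), `eq_zero_of_eigen_eigen`
  (a `p`-power-torsion `x` with `Eig_r(x)` and `Eig_{r′}(x)`, `r − r′` a unit, is `0` — Bézout; cf. -w2 g7 `CMPrimes.eq_zero_of_eigen_of_eigen`);
* §2 `coe_proj_add_coe_proj` (the two eigen-projectors sum to the identity), `primaryH1ToH1_eq_add` (for `y ∈ H¹(⊤, E[p^∞])`: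
  `P(R⁻¹ y) = P(R⁻¹(ι_* e_* y)) + P(R⁻¹(ι′_* e′_* y))`, p662922 splitting);
* §3 **`primaryH1ToH1_eq_of_eigen`**: if `x = P(R⁻¹ y)` satisfies `Eig_r(x)` then `x = P(R⁻¹(ι_* e_* y))` — the `r`-eigen classes in the image of
  `H¹(K, E[p^∞])` come from `H¹(K, M_r)`: the second summand is `Eig_r` (difference, §1) and `Eig_{r′}` (p666248 for `r′`), hence `0`.
CONSEQUENCE for (F2) of p665606: `f(𝔖_v(K, M_r) ⊓ L_{M_r}) ⊇ C_r ∩ P(res_⊤⁻¹{y : e_* y ∈ 𝔖_v ⊓ L_{M_r}})` — with `y = R y₀`, `y₀ ∈ Sel_{p^∞}(E/K)`,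
the remaining input is «`e_* (res_⊤ Sel_{p^∞}) ⊆ 𝔖_v ⊓ L_{M_r}`» = `π_*`-stability of `Sel_{p^∞}` (tree, under `HasLocalPointsMaps`) + the CM input at
`v` ((H1″): `W*`-components of classes classical at `v` are locally zero at `v`), recorded in `BOTTOM-VALUE-SNAKE-w7g2-v2.md` §2.

References: K. Rubin, LNM 1716 (1999) §2 [Rubin1999]; A. Agboola, Compositio 143 (2007) §6 [Agboola2007]; J.-P. Serre, *Galois Cohomology* I.§2
[SerreGaloisCohomology1997].
-/

noncomputable section

open scoped Classical

set_option linter.dupNamespace false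
set_option autoImplicit false

open NumberField IsDedekindDomain Field WeierstrassCurve
open Literature.NumberTheory.EllipticCurves Literature.NumberTheory.EllipticCurves.GreenbergSelmer
open Literature.NumberTheory.EllipticCurves.Castella2018.AcSelmer
open Literature.NumberTheory.EllipticCurves.Agboola2007
open Literature.NumberTheory.EllipticCurves.ResKernel
open Literature.NumberTheory.GaloisRepresentations

universe u

namespace Summit.BirchSwinnertonDyer.BirchSwinnertonDyer.Theorems.PrintCf2.RestrictedSelmerPair

/-! ## §1. Eigen predicates on an abelian group -/

section EigenAlgebra

variable {A : Type*} [AddCommGroup A] (Φ : A →+ A) {p : ℕ} [Fact p.Prime]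

/-- **The `s`-eigen predicate is closed under differences of `p`-power-torsion elements.** [folklore] -/
theorem eigen_sub {s : ℤ_[p]} {x₁ x₂ : A} {k₁ k₂ : ℕ} (hx₁ : p ^ k₁ • x₁ = 0) (hx₂ : p ^ k₂ • x₂ = 0)
    (h₁ : ∀ (k : ℕ) (N : ℤ), p ^ k • x₁ = 0 → ((N : ℤ_[p]) - s) ∈ (Ideal.span {(p : ℤ_[p]) ^ k} : Ideal ℤ_[p]) → Φ x₁ = N • x₁)
    (h₂ : ∀ (k : ℕ) (N : ℤ), p ^ k • x₂ = 0 → ((N : ℤ_[p]) - s) ∈ (Ideal.span {(p : ℤ_[p]) ^ k} : Ideal ℤ_[p]) → Φ x₂ = N • x₂) :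
    ∀ (k : ℕ) (N : ℤ), p ^ k • (x₁ - x₂) = 0 → ((N : ℤ_[p]) - s) ∈ (Ideal.span {(p : ℤ_[p]) ^ k} : Ideal ℤ_[p]) →
      Φ (x₁ - x₂) = N • (x₁ - x₂) := by
  intro k N hk hN
  -- a common level `K' = k + k₁ + k₂` and an approximation `N'` of `s` to order `p^K'`
  set K' := k + k₁ + k₂ with hK'
  set N' : ℤ := ((PadicInt.appr s K' : ℕ) : ℤ) with hN'def
  have hN' : ((N' : ℤ_[p]) - s) ∈ (Ideal.span {(p : ℤ_[p]) ^ K'} : Ideal ℤ_[p]) := by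
    have h := PadicInt.appr_spec K' s
    rw [← Ideal.neg_mem_iff, neg_sub] at h
    rw [hN'def]
    push_cast
    exact h
  have hle : ∀ {j : ℕ}, j ≤ K' → (Ideal.span {(p : ℤ_[p]) ^ K'} : Ideal ℤ_[p]) ≤ Ideal.span {(p : ℤ_[p]) ^ j} :=
    fun hj ↦ Ideal.span_singleton_le_span_singleton.mpr (pow_dvd_pow _ hj)
  have hx₁' : p ^ K' • x₁ = 0 := by
    rw [hK', show k + k₁ + k₂ = (k + k₂) + k₁ by omega, pow_add, mul_smul, hx₁, smul_zero]
  have hx₂' : p ^ K' • x₂ = 0 := by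
    rw [hK', pow_add, mul_smul, hx₂, smul_zero]
  have e₁ := h₁ K' N' hx₁' hN'
  have e₂ := h₂ K' N' hx₂' hN'
  rw [map_sub, e₁, e₂, ← zsmul_sub]
  exact CMPrimes.zsmul_eq_zsmul_of_pow_dvd_sub hk (CMPrimes.pow_dvd_sub_of_sub_mem_span (hle (by omega) hN') hN)

/-- **A `p`-power-torsion element which is an `r`- and an `r′`-eigenvector with `r − r′` a unit is `0`** (Bézout; cf. -w2 g7
`CMPrimes.eq_zero_of_eigen_of_eigen`, stated here for one element of an arbitrary group). [folklore] -/
theorem eq_zero_of_eigen_eigen {r r' : ℤ_[p]} (hunit : IsUnit (r - r')) {x : A} {k : ℕ} (hx : p ^ k • x = 0)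
    (h₁ : ∀ (j : ℕ) (N : ℤ), p ^ j • x = 0 → ((N : ℤ_[p]) - r) ∈ (Ideal.span {(p : ℤ_[p]) ^ j} : Ideal ℤ_[p]) → Φ x = N • x)
    (h₂ : ∀ (j : ℕ) (N : ℤ), p ^ j • x = 0 → ((N : ℤ_[p]) - r') ∈ (Ideal.span {(p : ℤ_[p]) ^ j} : Ideal ℤ_[p]) → Φ x = N • x) :
    x = 0 := by
  set N₁ : ℤ := ((PadicInt.appr r k : ℕ) : ℤ) with hN₁def
  set N₂ : ℤ := ((PadicInt.appr r' k : ℕ) : ℤ) with hN₂def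
  have hN₁ : ((N₁ : ℤ_[p]) - r) ∈ (Ideal.span {(p : ℤ_[p]) ^ k} : Ideal ℤ_[p]) := by
    have h := PadicInt.appr_spec k r
    rw [← Ideal.neg_mem_iff, neg_sub] at h
    rw [hN₁def]; push_cast; exact h
  have hN₂ : ((N₂ : ℤ_[p]) - r') ∈ (Ideal.span {(p : ℤ_[p]) ^ k} : Ideal ℤ_[p]) := by
    have h := PadicInt.appr_spec k r'
    rw [← Ideal.neg_mem_iff, neg_sub] at h
    rw [hN₂def]; push_cast; exact h
  have e₁ := h₁ k N₁ hx hN₁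
  have e₂ := h₂ k N₂ hx hN₂
  have hdiff : (N₁ - N₂) • x = 0 := by
    rw [sub_zsmul, ← e₁, ← e₂]
    abel
  have hcop : IsCoprime ((p : ℤ) ^ k) (N₁ - N₂) := by
    refine CMPrimes.isCoprime_pow_of_sub_mem_span_of_isUnit hunit ?_
    have : ((N₁ - N₂ : ℤ) : ℤ_[p]) - (r - r') = ((N₁ : ℤ_[p]) - r) - ((N₂ : ℤ_[p]) - r') := by push_cast; ring
    rw [this]
    exact Ideal.sub_mem _ hN₁ hN₂
  obtain ⟨a, b, hab⟩ := hcop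
  have hx' : ((p : ℤ) ^ k) • x = 0 := by
    rw [← natCast_zsmul] at hx
    exact_mod_cast hx
  calc x = (1 : ℤ) • x := (one_zsmul x).symm
    _ = (a * (p : ℤ) ^ k + b * (N₁ - N₂)) • x := by rw [hab]
    _ = 0 := by rw [add_zsmul, mul_zsmul, mul_zsmul, hx', hdiff, zsmul_zero, zsmul_zero, add_zero]

end EigenAlgebra

/-! ## §2. The two eigen-projectors and the decomposition of `P ∘ R⁻¹` -/

section Decomposition

variable {K : Type u} [Field K] [NumberField K] (V : WeierstrassCurve K) (p : ℕ) [Fact p.Prime]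
  (π : V.endRing) (r r' : ℤ_[p])
  (e : V.geomPrimaryTorsion p →+ ↥(V.endEigenPrimaryTorsion p π r))
  (e' : V.geomPrimaryTorsion p →+ ↥(V.endEigenPrimaryTorsion p π r'))

omit [NumberField K] in
/-- **Complementary eigen-projectors sum to the identity**: if `e` is the identity on `M_r` and `x − e x ∈ M_{r′}`, and `e′` is the identity on
`M_{r′}` and zero on `M_r`, then `e x + e′ x = x`. [folklore] -/
theorem coe_proj_add_coe_proj
    (hesub : ∀ x, x - (e x : V.geomPrimaryTorsion p) ∈ V.endEigenPrimaryTorsion p π r')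
    (he'₁ : ∀ x : ↥(V.endEigenPrimaryTorsion p π r'), e' x = x) (he'₂ : ∀ x ∈ V.endEigenPrimaryTorsion p π r, e' x = 0)
    (x : V.geomPrimaryTorsion p) :
    (e x : V.geomPrimaryTorsion p) + (e' x : V.geomPrimaryTorsion p) = x := by
  have h1 : e' x = e' (e x : V.geomPrimaryTorsion p) + e' (x - (e x : V.geomPrimaryTorsion p)) := by
    rw [← map_add, add_sub_cancel]
  have h2 : e' (e x : V.geomPrimaryTorsion p) = 0 := he'₂ _ (e x).2
  have h3 : (e' (x - (e x : V.geomPrimaryTorsion p)) : V.geomPrimaryTorsion p) = x - (e x : V.geomPrimaryTorsion p) := by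
    have := he'₁ ⟨x - (e x : V.geomPrimaryTorsion p), hesub x⟩
    exact congrArg Subtype.val this
  rw [h1, h2, zero_add, h3, add_sub_cancel]

omit [NumberField K] in
set_option maxHeartbeats 800000 in
/-- **Decomposition of `P ∘ R⁻¹` along the two summands**: for `y ∈ H¹(⊤, E[p^∞])`,
`P(R⁻¹ y) = P(R⁻¹(ι_* e_* y)) + P(R⁻¹(ι′_* e′_* y))` (p662922 `resH1Hom_subtype_proj_add_eq`). [cite: SerreGaloisCohomology1997, I.§2.4] -/
theorem primaryH1ToH1_eq_add
    (he : ∀ (σ : absoluteGaloisGroup K) (x : V.geomPrimaryTorsion p), e (σ • x) = σ • e x)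
    (he' : ∀ (σ : absoluteGaloisGroup K) (x : V.geomPrimaryTorsion p), e' (σ • x) = σ • e' x)
    (hsum : ∀ x, (e x : V.geomPrimaryTorsion p) + (e' x : V.geomPrimaryTorsion p) = x)
    (y : subgroupH1 (⊤ : Subgroup (absoluteGaloisGroup K)) (V.geomPrimaryTorsion p)) :
    ((V.primaryH1ToH1 p).comp (AddEquiv.ofBijective (resSubgroup (⊤ : Subgroup (absoluteGaloisGroup K)) (V.geomPrimaryTorsion p))
        (resSubgroup_top_bijective (G := absoluteGaloisGroup K) (V.geomPrimaryTorsion p))).symm.toAddMonoidHom) y =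
      ((V.primaryH1ToH1 p).comp (AddEquiv.ofBijective (resSubgroup (⊤ : Subgroup (absoluteGaloisGroup K)) (V.geomPrimaryTorsion p))
          (resSubgroup_top_bijective (G := absoluteGaloisGroup K) (V.geomPrimaryTorsion p))).symm.toAddMonoidHom)
        (resH1Hom (ContinuousMonoidHom.id _) (V.endEigenPrimaryTorsion p π r).subtype (fun _ _ ↦ rfl)
          (resH1Hom (ContinuousMonoidHom.id _) e (fun σ x ↦ by rw [Subgroup.smul_def, Subgroup.smul_def]; exact he σ x) y)) +
      ((V.primaryH1ToH1 p).comp (AddEquiv.ofBijective (resSubgroup (⊤ : Subgroup (absoluteGaloisGroup K)) (V.geomPrimaryTorsion p))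
          (resSubgroup_top_bijective (G := absoluteGaloisGroup K) (V.geomPrimaryTorsion p))).symm.toAddMonoidHom)
        (resH1Hom (ContinuousMonoidHom.id _) (V.endEigenPrimaryTorsion p π r').subtype (fun _ _ ↦ rfl)
          (resH1Hom (ContinuousMonoidHom.id _) e' (fun σ x ↦ by rw [Subgroup.smul_def, Subgroup.smul_def]; exact he' σ x) y)) := by
  have h := resH1Hom_subtype_proj_add_eq V p π r r' ⊤ e e' he he' hsum y
  conv_lhs => rw [← h]
  rw [map_add]

end Decomposition

/-! ## §3. The `r`-eigen classes in the image of `H¹(K, E[p^∞])` come from `H¹(K, E[𝔮_r^∞])` -/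

section EigenImage

variable {K : Type u} [Field K] [NumberField K] (V : WeierstrassCurve K) (p : ℕ) [Fact p.Prime]
  (π : V.endRing) (r r' : ℤ_[p])
  (f₀ : V.geomPoints →+ V.geomPoints) (hf₀ : ∀ (σ : absoluteGaloisGroup K) (P : V.geomPoints), f₀ (σ • P) = σ • f₀ P)
  (hfr : ∀ (k : ℕ) (N : ℤ) (x : V.geomPrimaryTorsion p), x ∈ V.endEigenPrimaryTorsion p π r → p ^ k • x = 0 →
    ((N : ℤ_[p]) - r) ∈ (Ideal.span {(p : ℤ_[p]) ^ k} : Ideal ℤ_[p]) → f₀ (x : V.geomPoints) = N • (x : V.geomPoints))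
  (hfr' : ∀ (k : ℕ) (N : ℤ) (x : V.geomPrimaryTorsion p), x ∈ V.endEigenPrimaryTorsion p π r' → p ^ k • x = 0 →
    ((N : ℤ_[p]) - r') ∈ (Ideal.span {(p : ℤ_[p]) ^ k} : Ideal ℤ_[p]) → f₀ (x : V.geomPoints) = N • (x : V.geomPoints))

set_option maxHeartbeats 800000 in
include hfr hfr' in
/-- **THE `𝔮_r`-EIGEN CLASSES IN THE IMAGE OF `H¹(K, E[p^∞])` COME FROM `H¹(K, E[𝔮_r^∞])`.** With complementary eigen-summands (`⊓ = ⊥`,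
`⊔ = ⊤`, `r − r′` a unit) and `f₀` acting on `E[𝔮_r^∞]` as `r` and on `E[𝔮_{r′}^∞]` as `r′`: if `x = P(R⁻¹ y)` satisfies
`∀ k N, p^k • x = 0 → N ≡ r (p^k) → galH1Map f₀ x = N • x`, then `x = P(R⁻¹(ι_* e_* y))` for the eigen-projector `e` of p662922, i.e.
`x` is the image of the class `e_* y ∈ H¹(⊤, E[𝔮_r^∞])` under the Ш-map `f` of p665244. [cite: Rubin1999, §2] [cite: Agboola2007, §6] -/
theorem primaryH1ToH1_eq_of_eigen
    (hinf : V.endEigenPrimaryTorsion p π r ⊓ V.endEigenPrimaryTorsion p π r' = ⊥)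
    (hsup : V.endEigenPrimaryTorsion p π r ⊔ V.endEigenPrimaryTorsion p π r' = ⊤) (hunit : IsUnit (r - r'))
    (e : V.geomPrimaryTorsion p →+ ↥(V.endEigenPrimaryTorsion p π r))
    (hesub : ∀ x, x - (e x : V.geomPrimaryTorsion p) ∈ V.endEigenPrimaryTorsion p π r')
    (he : ∀ (σ : absoluteGaloisGroup K) (x : V.geomPrimaryTorsion p), e (σ • x) = σ • e x)
    (y : subgroupH1 (⊤ : Subgroup (absoluteGaloisGroup K)) (V.geomPrimaryTorsion p))
    (hx : ∀ (k : ℕ) (N : ℤ), p ^ k • ((V.primaryH1ToH1 p).comp (AddEquiv.ofBijective (resSubgroup (⊤ : Subgroup (absoluteGaloisGroup K)) (V.geomPrimaryTorsion p))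
        (resSubgroup_top_bijective (G := absoluteGaloisGroup K) (V.geomPrimaryTorsion p))).symm.toAddMonoidHom) y = 0 →
      ((N : ℤ_[p]) - r) ∈ (Ideal.span {(p : ℤ_[p]) ^ k} : Ideal ℤ_[p]) →
      galH1Map f₀ hf₀ (((V.primaryH1ToH1 p).comp (AddEquiv.ofBijective (resSubgroup (⊤ : Subgroup (absoluteGaloisGroup K)) (V.geomPrimaryTorsion p))
        (resSubgroup_top_bijective (G := absoluteGaloisGroup K) (V.geomPrimaryTorsion p))).symm.toAddMonoidHom) y) =
      N • ((V.primaryH1ToH1 p).comp (AddEquiv.ofBijective (resSubgroup (⊤ : Subgroup (absoluteGaloisGroup K)) (V.geomPrimaryTorsion p))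
        (resSubgroup_top_bijective (G := absoluteGaloisGroup K) (V.geomPrimaryTorsion p))).symm.toAddMonoidHom) y) :
    ((V.primaryH1ToH1 p).comp (AddEquiv.ofBijective (resSubgroup (⊤ : Subgroup (absoluteGaloisGroup K)) (V.geomPrimaryTorsion p))
        (resSubgroup_top_bijective (G := absoluteGaloisGroup K) (V.geomPrimaryTorsion p))).symm.toAddMonoidHom) y =
      ((V.primaryH1ToH1 p).comp (AddEquiv.ofBijective (resSubgroup (⊤ : Subgroup (absoluteGaloisGroup K)) (V.geomPrimaryTorsion p))
          (resSubgroup_top_bijective (G := absoluteGaloisGroup K) (V.geomPrimaryTorsion p))).symm.toAddMonoidHom)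
        (resH1Hom (ContinuousMonoidHom.id _) (V.endEigenPrimaryTorsion p π r).subtype (fun _ _ ↦ rfl)
          (resH1Hom (ContinuousMonoidHom.id _) e (fun σ x ↦ by rw [Subgroup.smul_def, Subgroup.smul_def]; exact he σ x) y)) := by
  -- the complementary projector `e′` (roles of `r`, `r′` exchanged)
  obtain ⟨e', he'₁, he'₂, -, he'⟩ := exists_eigenProjector V p π r' r (by rw [inf_comm]; exact hinf) (by rw [sup_comm]; exact hsup)
  have hsum := coe_proj_add_coe_proj V p π r r' e e' hesub he'₁ he'₂
  set Re := AddEquiv.ofBijective (resSubgroup (⊤ : Subgroup (absoluteGaloisGroup K)) (V.geomPrimaryTorsion p)) (resSubgroup_top_bijective (G := absoluteGaloisGroup K) (V.geomPrimaryTorsion p)) with hRe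
  set x := ((V.primaryH1ToH1 p).comp Re.symm.toAddMonoidHom) y with hxdef
  set x₁ := ((V.primaryH1ToH1 p).comp Re.symm.toAddMonoidHom)
    (resH1Hom (ContinuousMonoidHom.id _) (V.endEigenPrimaryTorsion p π r).subtype (fun _ _ ↦ rfl)
      (resH1Hom (ContinuousMonoidHom.id _) e (fun σ x ↦ by rw [Subgroup.smul_def, Subgroup.smul_def]; exact he σ x) y)) with hx₁def
  set x₂ := ((V.primaryH1ToH1 p).comp Re.symm.toAddMonoidHom)
    (resH1Hom (ContinuousMonoidHom.id _) (V.endEigenPrimaryTorsion p π r').subtype (fun _ _ ↦ rfl)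
      (resH1Hom (ContinuousMonoidHom.id _) e' (fun σ x ↦ by rw [Subgroup.smul_def, Subgroup.smul_def]; exact he' σ x) y)) with hx₂def
  have hdec : x = x₁ + x₂ := primaryH1ToH1_eq_add V p π r r' e e' he he' hsum y
  -- `x₁` is in the range of the Ш-map for `M_r` (with `S = ⊤`), `x₂` in that for `M_{r′}`
  have hx₁mem : x₁ ∈ (((V.primaryH1ToH1 p).comp Re.symm.toAddMonoidHom).comp
      ((resH1Hom (ContinuousMonoidHom.id _) (V.endEigenPrimaryTorsion p π r).subtype (fun _ _ ↦ rfl)).comp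
        (⊤ : AddSubgroup (subgroupH1 (⊤ : Subgroup (absoluteGaloisGroup K)) ↥(V.endEigenPrimaryTorsion p π r))).subtype)).range :=
    ⟨⟨resH1Hom (ContinuousMonoidHom.id _) e (fun σ x ↦ by rw [Subgroup.smul_def, Subgroup.smul_def]; exact he σ x) y, AddSubgroup.mem_top _⟩, rfl⟩
  have hx₂mem : x₂ ∈ (((V.primaryH1ToH1 p).comp Re.symm.toAddMonoidHom).comp
      ((resH1Hom (ContinuousMonoidHom.id _) (V.endEigenPrimaryTorsion p π r').subtype (fun _ _ ↦ rfl)).comp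
        (⊤ : AddSubgroup (subgroupH1 (⊤ : Subgroup (absoluteGaloisGroup K)) ↥(V.endEigenPrimaryTorsion p π r'))).subtype)).range :=
    ⟨⟨resH1Hom (ContinuousMonoidHom.id _) e' (fun σ x ↦ by rw [Subgroup.smul_def, Subgroup.smul_def]; exact he' σ x) y, AddSubgroup.mem_top _⟩, rfl⟩
  obtain ⟨k₁, hk₁⟩ := exists_pow_smul_eq_zero_of_mem_range_shaMap V p π r ⊤ hx₁mem
  obtain ⟨k₂, hk₂⟩ := exists_pow_smul_eq_zero_of_mem_range_shaMap V p π r' ⊤ hx₂mem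
  have hEig₁ : ∀ (k : ℕ) (N : ℤ), p ^ k • x₁ = 0 → ((N : ℤ_[p]) - r) ∈ (Ideal.span {(p : ℤ_[p]) ^ k} : Ideal ℤ_[p]) →
      galH1Map f₀ hf₀ x₁ = N • x₁ :=
    fun k N hk hN ↦ galH1Map_eq_zsmul_of_mem_range_shaMap V p π r f₀ hf₀ hfr ⊤ hx₁mem k N hk hN
  have hEig₂' : ∀ (k : ℕ) (N : ℤ), p ^ k • x₂ = 0 → ((N : ℤ_[p]) - r') ∈ (Ideal.span {(p : ℤ_[p]) ^ k} : Ideal ℤ_[p]) →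
      galH1Map f₀ hf₀ x₂ = N • x₂ :=
    fun k N hk hN ↦ galH1Map_eq_zsmul_of_mem_range_shaMap V p π r' f₀ hf₀ hfr' ⊤ hx₂mem k N hk hN
  -- `x` is `p`-power torsion and `r`-eigen; hence so is `x₂ = x − x₁`
  have hxk : p ^ (k₁ + k₂) • x = 0 := by
    rw [hdec, smul_add, pow_add, mul_comm, mul_smul, hk₁, smul_zero, zero_add, mul_comm, mul_smul, hk₂, smul_zero]
  have hx₂eq : x₂ = x - x₁ := by rw [hdec, add_sub_cancel_left]
  have hEig₂ : ∀ (k : ℕ) (N : ℤ), p ^ k • x₂ = 0 → ((N : ℤ_[p]) - r) ∈ (Ideal.span {(p : ℤ_[p]) ^ k} : Ideal ℤ_[p]) →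
      galH1Map f₀ hf₀ x₂ = N • x₂ := by
    rw [hx₂eq]
    exact eigen_sub (galH1Map f₀ hf₀) hxk hk₁ hx hEig₁
  have hx₂0 : x₂ = 0 := eq_zero_of_eigen_eigen (galH1Map f₀ hf₀) hunit hk₂ hEig₂ hEig₂'
  rw [hdec, hx₂0, add_zero]

end EigenImage

end Summit.BirchSwinnertonDyer.BirchSwinnertonDyer.Theorems.PrintCf2.RestrictedSelmerPair

end
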